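import Summits.CriticalPhenomena.CardyFormulaZ2.Theses.CardyBoundaryCoulombGas
import Literature.Probability.RandomPlanarGeometry.CardyFunctionIncBeta

/-!
# `PureProductIntegrates` (support item stmt-CriticalPhenomena-5664, route CardyBoundaryCoulombGas)

Pure calculus: a function `P` on `(c, ∞)` with right limit `0` at `c` and derivative
`(cardyConst/3)·((b−a)(c−b)(c−a))^{1/3}·((x−a)(x−b)(x−c))^{−2/3}` equals
`F(η(a,b,c,x))`, `F` = Cardy's function, `η` = Cardy's cross-ratio of `(a, b, c, x)`.

Proof: with `η(x) = (b−a)(x−c)/((c−a)(x−b)) ∈ (0,1)` for `a < b < c < x`,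
`η(1−η) = Δ·Q/K³` and `η' = Δ/K²` where `Δ = (b−a)(c−b)(c−a)`, `Q = (x−a)(x−b)(x−c)`,
`K = (c−a)(x−b)`; the chain rule with `F'(η) = (cardyConst/3)(η(1−η))^{−2/3}`
(`hasDerivAt_cardyFunction_holds`, Cardy 1992 eq. (8)) gives exactly the pure product, so
`P − F∘η` has zero derivative on the connected open set `(c, ∞)`, hence is constant, and both
`P` and `F∘η` tend to `0` at `c⁺` (`continuousOn_cardyFunction_holds`, `cardyFunction_zero`).
-/

noncomputable section

open Set Filter Topology

namespace Summit.CriticalPhenomena.CardyFormulaZ2.Theorems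

open Literature.Probability.RandomPlanarGeometry

/-- The `rpow` bookkeeping behind Cardy's pure product: for positive `Δ, Q, K`,
`(Δ Q / K³)^{-2/3} · (Δ / K²) = Δ^{1/3} · Q^{-2/3}`. [folklore] -/
theorem pureProduct_rpow_identity {Δ Q K : ℝ} (hΔ : 0 < Δ) (hQ : 0 < Q) (hK : 0 < K) :
    (Δ * Q / K ^ 3) ^ (-(2 / 3 : ℝ)) * (Δ / K ^ 2) = Δ ^ (1 / 3 : ℝ) * Q ^ (-(2 / 3) : ℝ) := by
  have hK3 : (K ^ 3 : ℝ) ^ (-(2 / 3 : ℝ)) = (K ^ 2)⁻¹ := by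
    rw [show (K ^ 3 : ℝ) = K ^ ((3 : ℕ) : ℝ) from (Real.rpow_natCast K 3).symm,
      ← Real.rpow_mul hK.le, show ((3 : ℕ) : ℝ) * (-(2 / 3 : ℝ)) = -((2 : ℕ) : ℝ) by norm_num,
      Real.rpow_neg hK.le, Real.rpow_natCast]
  have h1 : Δ ^ (-(2 / 3 : ℝ)) * Δ = Δ ^ (1 / 3 : ℝ) := by
    rw [← Real.rpow_add_one hΔ.ne']
    norm_num
  rw [Real.div_rpow (by positivity) (by positivity), Real.mul_rpow hΔ.le hQ.le, hK3,
    div_inv_eq_mul]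
  have hK2 : (K ^ 2 : ℝ) ≠ 0 := by positivity
  calc Δ ^ (-(2 / 3 : ℝ)) * Q ^ (-(2 / 3 : ℝ)) * K ^ 2 * (Δ / K ^ 2)
        = Δ ^ (-(2 / 3 : ℝ)) * Δ * Q ^ (-(2 / 3 : ℝ)) * (K ^ 2 / K ^ 2) := by ring
    _ = Δ ^ (1 / 3 : ℝ) * Q ^ (-(2 / 3) : ℝ) := by rw [h1, div_self hK2, mul_one]

/-- Cardy's cross-ratio of `(a, b, c, x)` in closed form:
`η = (b−a)(x−c)/((c−a)(x−b))`. [folklore] -/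
theorem crossRatio_abcx (a b c x : ℝ) :
    crossRatio ![a, b, c, x] = (b - a) * (x - c) / ((c - a) * (x - b)) := by
  simp only [crossRatio, Matrix.cons_val_zero, Matrix.cons_val_one, Matrix.cons_val]
  rw [show (a - b) * (c - x) = (b - a) * (x - c) by ring,
    show (a - c) * (b - x) = (c - a) * (x - b) by ring]

/-- The derivative in the fourth point of Cardy's cross-ratio of `(a, b, c, x)`:
`∂ₓ η = (b−a)(c−b)/((c−a)(x−b)²)` (for `x ≠ b`, `a ≠ c`). [folklore] -/
theorem hasDerivAt_crossRatio_fourth {a b c x : ℝ} (hac : a ≠ c) (hxb : x ≠ b) :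
    HasDerivAt (fun y : ℝ ↦ crossRatio ![a, b, c, y])
      ((b - a) * (c - b) / ((c - a) * (x - b) ^ 2)) x := by
  have hfun : (fun y : ℝ ↦ crossRatio ![a, b, c, y]) =
      fun y : ℝ ↦ (b - a) * (y - c) / ((c - a) * (y - b)) := by
    funext y
    exact crossRatio_abcx a b c y
  rw [hfun]
  have hN : HasDerivAt (fun y : ℝ ↦ (b - a) * (y - c)) ((b - a) * 1) x :=
    ((hasDerivAt_id x).sub_const c).const_mul (b - a)
  have hD : HasDerivAt (fun y : ℝ ↦ (c - a) * (y - b)) ((c - a) * 1) x :=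
    ((hasDerivAt_id x).sub_const b).const_mul (c - a)
  have hD0 : (c - a) * (x - b) ≠ 0 := mul_ne_zero (sub_ne_zero.2 (Ne.symm hac)) (sub_ne_zero.2 hxb)
  refine (hN.div hD hD0).congr_deriv ?_
  have hca : c - a ≠ 0 := sub_ne_zero.2 (Ne.symm hac)
  have hxb' : x - b ≠ 0 := sub_ne_zero.2 hxb
  field_simp
  ring

/-- Chain rule: for `a < b < c < x`, `x ↦ F(η(a,b,c,x))` has derivative
`(cardyConst/3)·((b−a)(c−b)(c−a))^{1/3}·((x−a)(x−b)(x−c))^{−2/3}` — Cardy's pure product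
(Cardy 1992, eq. (8) composed with the cross-ratio). [folklore] -/
theorem hasDerivAt_cardyFunction_crossRatio {a b c x : ℝ} (hab : a < b) (hbc : b < c)
    (hcx : c < x) :
    HasDerivAt (fun y : ℝ ↦ cardyFunction (crossRatio ![a, b, c, y]))
      (cardyConst / 3 * ((b - a) * (c - b) * (c - a)) ^ (1 / 3 : ℝ) *
        ((x - a) * (x - b) * (x - c)) ^ (-(2 / 3) : ℝ)) x := by
  have hsm : StrictMono ![a, b, c, x] := by
    refine Fin.strictMono_iff_lt_succ.2 fun i ↦ ?_
    fin_cases i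
    · simpa using hab
    · simpa using hbc
    · simpa using hcx
  have hη : crossRatio ![a, b, c, x] ∈ Ioo (0 : ℝ) 1 := crossRatio_mem_Ioo (Or.inl hsm)
  have hF := hasDerivAt_cardyFunction_holds hη
  have hηd := hasDerivAt_crossRatio_fourth (a := a) (b := b) (c := c) (x := x)
    (hab.trans hbc).ne (hbc.trans hcx).ne'
  have hcomp := hF.comp x hηd
  refine hcomp.congr_deriv ?_
  -- rewrite η(1-η) and η' through Δ, Q, K
  set Δ : ℝ := (b - a) * (c - b) * (c - a)
  set Q : ℝ := (x - a) * (x - b) * (x - c)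
  set K : ℝ := (c - a) * (x - b)
  have hΔ : 0 < Δ := by
    have h1 : 0 < b - a := sub_pos.2 hab
    have h2 : 0 < c - b := sub_pos.2 hbc
    have h3 : 0 < c - a := sub_pos.2 (hab.trans hbc)
    positivity
  have hQ : 0 < Q := by
    have h1 : 0 < x - a := sub_pos.2 ((hab.trans hbc).trans hcx)
    have h2 : 0 < x - b := sub_pos.2 (hbc.trans hcx)
    have h3 : 0 < x - c := sub_pos.2 hcx
    positivity
  have hK : 0 < K := by
    have h2 : 0 < x - b := sub_pos.2 (hbc.trans hcx)
    have h3 : 0 < c - a := sub_pos.2 (hab.trans hbc)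
    positivity
  have hca : c - a ≠ 0 := (sub_pos.2 (hab.trans hbc)).ne'
  have hxb : x - b ≠ 0 := (sub_pos.2 (hbc.trans hcx)).ne'
  have hprod : crossRatio ![a, b, c, x] * (1 - crossRatio ![a, b, c, x]) = Δ * Q / K ^ 3 := by
    rw [crossRatio_abcx]
    field_simp
    ring
  have hder : (b - a) * (c - b) / ((c - a) * (x - b) ^ 2) = Δ / K ^ 2 := by
    field_simp
    ring
  rw [hprod, hder, mul_assoc, pureProduct_rpow_identity hΔ hQ hK, ← mul_assoc]

/-- For `a < b < c`, `F(η(a,b,c,x)) → 0` as `x → c⁺` (`η → 0⁺`, `F` continuous on `[0,1]` with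
`F(0) = 0`). [folklore] -/
theorem tendsto_cardyFunction_crossRatio_right {a b c : ℝ} (hab : a < b) (hbc : b < c) :
    Tendsto (fun y : ℝ ↦ cardyFunction (crossRatio ![a, b, c, y])) (𝓝[>] c) (𝓝 0) := by
  have hca : c - a ≠ 0 := (sub_pos.2 (hab.trans hbc)).ne'
  have hcb : c - b ≠ 0 := (sub_pos.2 hbc).ne'
  -- η is continuous at c with value 0, and maps (c, ∞) into (0,1) ⊆ [0,1]
  have hηcont : ContinuousAt (fun y : ℝ ↦ (b - a) * (y - c) / ((c - a) * (y - b))) c := by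
    have h1 : ContinuousAt (fun y : ℝ ↦ (b - a) * (y - c)) c := by fun_prop
    have h2 : ContinuousAt (fun y : ℝ ↦ (c - a) * (y - b)) c := by fun_prop
    exact h1.div h2 (mul_ne_zero hca hcb)
  have hη0 : (b - a) * (c - c) / ((c - a) * (c - b)) = 0 := by simp
  have hηt : Tendsto (fun y : ℝ ↦ crossRatio ![a, b, c, y]) (𝓝[>] c) (𝓝[Icc 0 1] 0) := by
    have hfun : (fun y : ℝ ↦ crossRatio ![a, b, c, y]) =
        fun y : ℝ ↦ (b - a) * (y - c) / ((c - a) * (y - b)) := by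
      funext y
      exact crossRatio_abcx a b c y
    rw [hfun]
    refine tendsto_nhdsWithin_iff.2 ⟨?_, ?_⟩
    · have := hηcont.tendsto
      rw [hη0] at this
      exact this.mono_left nhdsWithin_le_nhds
    · filter_upwards [self_mem_nhdsWithin] with y hy
      have hsm : StrictMono ![a, b, c, y] := by
        refine Fin.strictMono_iff_lt_succ.2 fun i ↦ ?_
        fin_cases i
        · simpa using hab
        · simpa using hbc
        · simpa using hy
      have := crossRatio_mem_Ioo (Or.inl hsm)
      rw [crossRatio_abcx] at this
      exact Ioo_subset_Icc_self this
  have hF : ContinuousWithinAt cardyFunction (Icc 0 1) 0 :=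
    continuousOn_cardyFunction_holds 0 ⟨le_rfl, zero_le_one⟩
  have := hF.tendsto.comp hηt
  simpa only [Function.comp_def, cardyFunction_zero] using this

/-- **`PureProductIntegrates`** (item stmt-CriticalPhenomena-5664 of route CardyBoundaryCoulombGas):
a function on `(c, ∞)` with right limit `0` at `c` whose derivative is Cardy's pure product
`(cardyConst/3)·((b−a)(c−b)(c−a))^{1/3}·((x−a)(x−b)(x−c))^{−2/3}` is `F ∘ η`. [folklore] -/
theorem PureProductIntegrates_proof :
    Summit.CriticalPhenomena.CardyFormulaZ2.Theses.CardyBoundaryCoulombGas.PureProductIntegrates := by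
  unfold Summit.CriticalPhenomena.CardyFormulaZ2.Theses.CardyBoundaryCoulombGas.PureProductIntegrates
  intro a b c P hab hbc hP0 hPd x hcx
  set G : ℝ → ℝ := fun y ↦ cardyFunction (crossRatio ![a, b, c, y])
  -- H := P - G has zero derivative on the open connected set (c, ∞)
  have hHd : ∀ y ∈ Ioi c, HasDerivAt (fun z ↦ P z - G z) 0 y := by
    intro y hy
    have h := (hPd y hy).sub (hasDerivAt_cardyFunction_crossRatio hab hbc hy)
    rwa [sub_self] at h
  have hdiff : DifferentiableOn ℝ (fun z ↦ P z - G z) (Ioi c) := fun y hy ↦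
    (hHd y hy).differentiableAt.differentiableWithinAt
  have hder : (Ioi c).EqOn (deriv fun z ↦ P z - G z) 0 := fun y hy ↦ (hHd y hy).deriv
  have hconst : ∀ y ∈ Ioi c, P y - G y = P x - G x := fun y hy ↦
    isOpen_Ioi.is_const_of_deriv_eq_zero isPreconnected_Ioi hdiff hder hy hcx
  -- both P and G tend to 0 at c⁺, so the constant is 0
  have hlim : Tendsto (fun z ↦ P z - G z) (𝓝[>] c) (𝓝 (0 - 0)) :=
    hP0.sub (tendsto_cardyFunction_crossRatio_right hab hbc)
  rw [sub_zero] at hlim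
  have hlim' : Tendsto (fun z ↦ P z - G z) (𝓝[>] c) (𝓝 (P x - G x)) := by
    refine (tendsto_const_nhds (x := P x - G x)).congr' ?_
    filter_upwards [self_mem_nhdsWithin] with y hy
    exact (hconst y hy).symm
  have h0 : P x - G x = 0 := tendsto_nhds_unique hlim' hlim
  exact sub_eq_zero.1 h0

end Summit.CriticalPhenomena.CardyFormulaZ2.Theorems

end
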